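import Summits.QuantumFields.BalabanUV.T4Continuum.Support.ShellMeasureLinearizedFromQ

/-!
# `T4Continuum.ShellMeasureLandauCorrectionFromQ` — W-a (Cf) INTO END-II, file 1∕2, the GENERIC HALF: END-II's
# Landau-correction binders `hCd` ∕ `hCq` ∕ `hCr` for `Cf := 1_{ball 0 R}·(Q − DQ(0))` are KERNEL from (Q1)–(Q3)(+(Q4)) of ANY
# chart map `Q`, or from a printed-shape decomposition `Q = T + O(‖·‖²)`; B11 Sect. C's correction `D` then EXISTS along
# every holomorphic curve (ONE call of `ShellMeasureLandauFixedPoint.landauCorrection_along`)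
(cell `pub-balaban`, sub-cell `t4`, spine estimate NE7c (node U5b); NE7c ROUND-2 crew `t4-ne7c-formalise-*`, unit
`b2b-balaban-t4-ne7c-formalise-leaf-08` gen 11 — the lineage of rows S46 `ShellMeasureLinearizedFromQ` ∕ S52
`ShellMeasureLinearizedGammaT(End)` (the W-d junctions); STANDING OFFER journal l.14614 ∕ COORDINATION l.14830 ∕ l.14923 —
an UNBOOKED COMPANION of owner table v2.7 row S64 «W-a (Cf) JUNCTION INTO END-II» (CLAIMED by leaf-04-g4: the `k`-UNIFORM
pair in b07 typing from S56 f3 `ShellMeasureAverageProp4General.prop4_general`) and of leaf-01-g5's one-step file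
`ShellMeasureAverageLandauCorrection`; file 2 = `ShellMeasureLandauCorrectionIterate` (the printed `k`-fold average over the
pyramid, b12 typing, from (52) alone); ADDITIVE — imports S46 `ShellMeasureLinearizedFromQ` (p218633; hence row D4's
`Beta.LinearizingChange267FromQ`, `ShellMeasureLandauFixedPoint`, S40 `ShellMeasureLinearizedRealStructure`) ONLY; ONE
data `def` (`landauCf`, an object, not a proposition), 0 `def … : Prop`, 0 sorry, 0 cite tags)

HONEST FRAMING.  Finite four-torus programme, rung (B)+1 only — NOT infinite volume, NOT a mass gap, NOT the Clay
problem, NOT summit progress; (B), `BetaPertHyp`, (B^μ) are not consumed.  NE7c (`T4IndicatorShell.ShellWeightBound`) is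
NOT PRINTED and NOT PROVED; «NE7c ⇐ the named binders».  ELEMENTARY COMPLEX ANALYSIS + JUNCTIONS BY NAME ([folklore]);
nothing printed is asserted or cited.

WHAT THE WALL ASKS (owner's `WALL-NE7c-P1.md` v1.6 §2 (a) — hypotheses of END-II
`ShellMeasureLandauHolonomyPrint.slotAC_realized_su2_landauChart_print`): «the Landau correction `Cf V : 𝒴′ → 𝒳`,
holomorphic on `ball 0 R_C` with `‖Cf V Z‖ ≤ C₂‖Z‖²` (B11 Prop. 3 (54)–(55), Sect. C)» — literally the binders
`hCd : ∀ V, DifferentiableOn ℂ (Cf V) (ball 0 RC)`, `hCq : ∀ V, ∀ Z, ‖Z‖ < RC → ‖Cf V Z‖ ≤ C₂ * ‖Z‖ ^ 2`,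
`hCr : ∀ V, ∀ Z ∈ 𝓡𝒴', Cf V Z ∈ 𝓡𝒳`, `hC₂ : 0 ≤ C₂`, consumed through `landauExp (Cf V) (ιs V) (Hop V) …`, whose fixed point is
`ShellMeasureLandauFixedPoint.landauCorrection_along` ([Balaban1985Variational] (50) «X → C_j(LʲηA′ − LʲηHX)», (52)–(55)).
Owner's FINDING F-ne7cp1-g28-1: that `Cf` IS the non-linear part `C_j` of the `j`-fold block-average chart map ((44)
«|C_j(LʲηA)| ≦ C₂(Lʲη)²|A|²», [4] = [Balaban1985Averaging] Prop. 4 (134) «Q_k(U₀, ηA) = Q_k(U₀)A + C_k(U₀, A)»).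

WHAT THIS FILE PROVES (kernel, 0 sorry) — for ANY map `Qt : 𝒴′ → 𝒳` of complex normed spaces:
* §1 from (Q1) `AnalyticOnNhd ℂ Qt (ball 0 R)`, (Q2) `Qt 0 = 0`, (Q3) `‖Qt‖ ≤ M_Q` on the ball — the object
  `landauCf Qt R := 1_{ball 0 R} · nonlin Qt` (row D4's `nonlin Qt = Qt − DQt(0)`, CUT OFF outside the ball so that the
  reality clause holds globally; inside the ball the Sect. C scheme never leaves it) satisfies END-II's binders LITERALLY:
  `differentiableOn_landauCf` (hCd, `RC = R`; also `analyticOnNhd_landauCf`), `norm_landauCf_le_sq` (hCq, `C₂ = Mq R M_Q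
  = 2M_Q∕R²` — row D4's `nonlin_sq_bound` BY NAME), `C₂_nonneg` (S46 `Mq_nonneg_of_Q`), and `hCr` in both currencies:
  `landauCf_mem_of_mapsTo` (ANY additive subgroups preserved by `Qt` on the ball and by `DQt(0)`) and
  `landauCf_mem_realSub` ((Q4) conjugation-equivariance on the ball ⟹ `Fix κ_𝒴′ ↦ Fix κ_𝒳`; S46
  `nonlin_conj_of_equivariant`, S40 `realSub`).
* §1b from a PRINTED-SHAPE decomposition «`‖Qt B − T B‖ ≤ C₂‖B‖²` on a ball, `T` continuous linear» ([B7] (134)–(135)):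
  the linear part is FORCED — `hasFDerivAt_zero_of_sq_bound` ∕ `fderiv_zero_eq_of_sq_bound` (`T = DQt(0)`, so print's
  «Q_k(U₀)» IS the Fréchet derivative and «C_k(U₀, ·)» IS `nonlin`), and `norm_landauCf_le_of_sq_bound` delivers hCq
  with the DISPLAYED constant, no `M_Q∕R²` loss — the socket for rows S55∕S56's `k`-UNIFORM `C₂ = e^{O(1)2α₀}8C₁` once
  `prop4_general` lands (leaf-10 lineage), ONE call.
* §2 THE PLUG INTO B11 SECT. C: `landauCorrection_along_of_Q` — `landauCorrection_along` CALLED with `C := landauCf Qt R`,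
  `C₂ := Mq R M_Q`, its hypothesis pair ((44) + [4] Prop. 7 in Fréchet form) DISCHARGED from (Q1)–(Q3): given a
  contraction `ι`, an operator `H` with (46)-TYPE bound `B₀`, the (54)-TYPE smallness `9·C₂·B₀·ε < 1` and `3ε ≤ R`, along
  every holomorphic curve `‖Y_σ‖ < ε` the Landau correction `σ ↦ D_σ` EXISTS, holomorphic, unique in its ball, with (55)
  `‖D_σ‖ ≤ 4C₂‖ι Y_σ‖²`.
WHAT STAYS DISPLAYED (W-a): the operators `H`∕`H₁`∕`𝒢` ((46)∕(103)∕(P2) = [5] Thms 3.12∕3.13), `W𝒱` ((P4)), the chart `Φ`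
((75)), B11's SECTIONED ∕ V-uniform use of all of them, the smallness numbers; [dict] (node O).  NOTHING in the countdown
moves.  HONEST DEPENDENCY (cell): continuum YM on T⁴ ⇐ BetaPertH ∧ nine spine estimates (0/9 proved); BetaPertH ⇐ (D1)
∧ (D4) ∧ CAP+tail; G-an2-4 gates asym, D1 and NE2/3/4.
-/

noncomputable section

open Set Metric

namespace Summit.QuantumFields.BalabanUV.T4Continuum.ShellMeasureLandauCorrectionFromQ

open Literature.MathematicalPhysics.QuantumFieldTheory.Balaban1983to89
open Summit.QuantumFields.BalabanUV.Beta.LinearizingChange267FromQ (nonlin Mq nonlin_sq_bound analyticOnNhd_nonlin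
  MQ_nonneg nonlin_zero)
open ShellMeasureLinearizedFromQ (Mq_nonneg_of_Q nonlin_conj_of_equivariant fderiv_zero_conj_of_equivariant)
open ShellMeasureLinearizedRealStructure (realSub mem_realSub)
open ShellMeasureLandauFixedPoint (landauCorrection_along)

variable {𝒴' 𝒳 : Type*} [NormedAddCommGroup 𝒴'] [NormedSpace ℂ 𝒴'] [NormedAddCommGroup 𝒳] [NormedSpace ℂ 𝒳]

/-! ## §1 The Landau-correction map read off a chart map: `landauCf Qt R = 1_{ball 0 R} · (Qt − DQt(0))` -/

/-- **THE LANDAU-CORRECTION MAP OF (44)∕(50) READ OFF A CHART MAP `Qt`**: the non-linear part `nonlin Qt = Qt − DQt(0)`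
(row D4; [B7] (134)'s `C_k` when `Qt` is the `k`-fold average chart map), cut off to `0` outside `ball 0 R` (the Sect. C
scheme only ever evaluates it inside the ball; the cut-off makes END-II's GLOBAL reality clause `hCr` hold).  An object,
not a proposition. [folklore] -/
def landauCf (Qt : 𝒴' → 𝒳) (R : ℝ) : 𝒴' → 𝒳 := (ball (0 : 𝒴') R).indicator (nonlin Qt)

variable {Qt : 𝒴' → 𝒳} {R MQ : ℝ}

/-- inside the ball `landauCf Qt R = nonlin Qt`. [folklore] -/
theorem landauCf_of_mem {Z : 𝒴'} (hZ : ‖Z‖ < R) :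
    landauCf Qt R Z = nonlin Qt Z :=
  indicator_of_mem (mem_ball_zero_iff.2 hZ) _

/-- outside the ball `landauCf Qt R = 0`. [folklore] -/
theorem landauCf_of_not_mem {Z : 𝒴'} (hZ : ¬ ‖Z‖ < R) : landauCf Qt R Z = 0 :=
  indicator_of_notMem (fun h => hZ (mem_ball_zero_iff.1 h)) _

/-- inside the ball, unfolded: `landauCf Qt R Z = Qt Z − DQt(0) Z` ([B7] (134) read as a definition of `C_k`).
[folklore] -/
theorem landauCf_eq_sub {Z : 𝒴'} (hZ : ‖Z‖ < R) : landauCf Qt R Z = Qt Z - fderiv ℂ Qt 0 Z := by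
  rw [landauCf_of_mem hZ]; rfl

/-- `landauCf Qt R 0 = 0` when (Q2) `Qt 0 = 0` (whatever `R`). [folklore] -/
theorem landauCf_zero (hQ0 : Qt 0 = 0) : landauCf Qt R 0 = 0 := by
  by_cases hR : ‖(0 : 𝒴')‖ < R
  · rw [landauCf_of_mem hR, nonlin_zero hQ0]
  · exact landauCf_of_not_mem hR

/-- on the OPEN ball the cut-off is invisible: `landauCf Qt R` and `nonlin Qt` agree on `ball 0 R`. [folklore] -/
theorem landauCf_eqOn : EqOn (landauCf Qt R) (nonlin Qt) (ball (0 : 𝒴') R) :=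
  fun _ hZ => indicator_of_mem hZ _

/-- **END-II's `hCd`**: (Q1) ⟹ `DifferentiableOn ℂ (landauCf Qt R) (ball 0 R)` (row D4's `analyticOnNhd_nonlin` on the
open ball, where the cut-off agrees with `nonlin Qt`). [folklore] -/
theorem differentiableOn_landauCf (hQa : AnalyticOnNhd ℂ Qt (ball 0 R)) :
    DifferentiableOn ℂ (landauCf Qt R) (ball (0 : 𝒴') R) :=
  (analyticOnNhd_nonlin hQa).differentiableOn.congr landauCf_eqOn

/-- … in fact ANALYTIC on the open ball ((44)'s «extended to analytic functions»). [folklore] -/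
theorem analyticOnNhd_landauCf (hQa : AnalyticOnNhd ℂ Qt (ball 0 R)) :
    AnalyticOnNhd ℂ (landauCf Qt R) (ball (0 : 𝒴') R) := fun Z hZ =>
  (analyticOnNhd_nonlin hQa Z hZ).congr
    (Filter.eventuallyEq_of_mem (isOpen_ball.mem_nhds hZ) fun _ hW => (landauCf_eqOn hW).symm)

/-- **END-II's `hCq`**: (Q1)–(Q3) ⟹ `‖landauCf Qt R Z‖ ≤ C₂‖Z‖²` for `‖Z‖ < R`, with `C₂ = Mq R M_Q = 2M_Q∕R²` (row D4's
`nonlin_sq_bound` BY NAME — the Cauchy estimate of the order-one remainder). [folklore] -/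
theorem norm_landauCf_le_sq [CompleteSpace 𝒳] (hR : 0 < R) (hQa : AnalyticOnNhd ℂ Qt (ball 0 R))
    (hQM : ∀ B ∈ ball (0 : 𝒴') R, ‖Qt B‖ ≤ MQ) (hQ0 : Qt 0 = 0) :
    ∀ Z : 𝒴', ‖Z‖ < R → ‖landauCf Qt R Z‖ ≤ Mq R MQ * ‖Z‖ ^ 2 := fun Z hZ => by
  rw [landauCf_of_mem hZ]
  simpa only [Mq] using nonlin_sq_bound hR hQa.differentiableOn hQM hQ0 Z (mem_ball_zero_iff.2 hZ)

omit [NormedSpace ℂ 𝒴'] [NormedSpace ℂ 𝒳] in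
/-- END-II's `hC₂ : 0 ≤ C₂` for this `C₂` (S46 `Mq_nonneg_of_Q`). [folklore] -/
theorem C₂_nonneg (hR : 0 < R) (hQM : ∀ B ∈ ball (0 : 𝒴') R, ‖Qt B‖ ≤ MQ) : 0 ≤ Mq R MQ :=
  Mq_nonneg_of_Q hR hQM

/-- **END-II's `hCr`, SUBGROUP CURRENCY**: if `Qt` maps the real fields of the ball into real values and so does its
derivative `DQt(0)`, then `landauCf Qt R` maps ALL real fields to real values (outside the ball it is `0`).  `𝓡𝒴′`, `𝓡𝒳`
are END-II's additive subgroups. [folklore] -/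
theorem landauCf_mem_of_mapsTo (𝓡𝒴' : AddSubgroup 𝒴') (𝓡𝒳 : AddSubgroup 𝒳)
    (hQr : ∀ Z ∈ 𝓡𝒴', ‖Z‖ < R → Qt Z ∈ 𝓡𝒳) (hLr : ∀ Z ∈ 𝓡𝒴', fderiv ℂ Qt 0 Z ∈ 𝓡𝒳) :
    ∀ Z ∈ 𝓡𝒴', landauCf Qt R Z ∈ 𝓡𝒳 := fun Z hZ => by
  by_cases hZR : ‖Z‖ < R
  · rw [landauCf_eq_sub hZR]; exact 𝓡𝒳.sub_mem (hQr Z hZ hZR) (hLr Z hZ)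
  · rw [landauCf_of_not_mem hZR]; exact 𝓡𝒳.zero_mem

/-- **END-II's `hCr`, CONJUGATION CURRENCY ((Q4))**: for conjugate-linear isometric involutions `κ_𝒴′`, `κ_𝒳` and a chart
map EQUIVARIANT ON THE BALL (`Qt (κ_𝒴′ B) = κ_𝒳 (Qt B)`, `‖B‖ < R` — for the printed average: S47's ⋆-equivariance),
`landauCf Qt R` maps `Fix κ_𝒴′` (S40's `realSub`) into `Fix κ_𝒳` — S46's `nonlin_conj_of_equivariant` on the ball, `0`
off it. [folklore] -/
theorem landauCf_mem_realSub {κY : 𝒴' ≃ₗᵢ⋆[ℂ] 𝒴'} {κX : 𝒳 ≃ₗᵢ⋆[ℂ] 𝒳} (hR : 0 < R)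
    (hQa : AnalyticOnNhd ℂ Qt (ball 0 R)) (hQt : ∀ B ∈ ball (0 : 𝒴') R, Qt (κY B) = κX (Qt B)) :
    ∀ Z ∈ (realSub κY).toAddSubgroup, landauCf Qt R Z ∈ (realSub κX).toAddSubgroup := fun Z hZ => by
  have hZ' : κY Z = Z := mem_realSub.1 hZ
  by_cases hZR : ‖Z‖ < R
  · show landauCf Qt R Z ∈ realSub κX
    rw [mem_realSub, landauCf_of_mem hZR]
    have h := nonlin_conj_of_equivariant hR hQa hQt Z hZR
    rw [hZ'] at h
    exact h.symm
  · show landauCf Qt R Z ∈ realSub κX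
    rw [landauCf_of_not_mem hZR]; exact (realSub κX).zero_mem

/-! ## §1b The same binders from a PRINTED-SHAPE decomposition `Q = T + C`, `‖C‖ ≤ C₂‖·‖²` ([B7] (134)–(135)):
the linear part is FORCED to be `DQ(0)`, so `landauCf` inherits the displayed constant (the `k`-uniform road, rows S55∕S56) -/

/-- **UNIQUENESS OF THE LINEAR PART**: a decomposition `Qt B = T B + O(‖B‖²)` near `0` with `T` continuous linear forces
`Qt 0 = 0` and `HasFDerivAt Qt T 0` — so [B7] (134)'s «Q_k(U₀)» IS the Fréchet derivative of the chart map at `0` and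
«C_k(U₀, ·)» IS row D4's `nonlin`.  (`‖·‖²` is little-o of the identity: `Asymptotics.isLittleO_norm_pow_id`.) [folklore] -/
theorem hasFDerivAt_zero_of_sq_bound {T : 𝒴' →L[ℂ] 𝒳} {C r : ℝ} (hr : 0 < r)
    (h : ∀ B ∈ ball (0 : 𝒴') r, ‖Qt B - T B‖ ≤ C * ‖B‖ ^ 2) : HasFDerivAt Qt T 0 := by
  have h0 : Qt 0 = 0 := by
    have h00 := h 0 (mem_ball_self hr)
    rw [map_zero, sub_zero, norm_zero, zero_pow two_ne_zero, mul_zero] at h00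
    exact norm_le_zero_iff.1 h00
  rw [hasFDerivAt_iff_isLittleO_nhds_zero]
  have hbig : (fun B : 𝒴' => Qt (0 + B) - Qt 0 - T B) =O[nhds (0 : 𝒴')] (fun B : 𝒴' => ‖B‖ ^ 2) := by
    refine Asymptotics.IsBigO.of_bound C ?_
    filter_upwards [ball_mem_nhds (0 : 𝒴') hr] with B hB
    rw [zero_add, h0, sub_zero, Real.norm_of_nonneg (by positivity)]
    exact h B hB
  exact hbig.trans_isLittleO (Asymptotics.isLittleO_norm_pow_id one_lt_two)

/-- … hence `fderiv ℂ Qt 0 = T`. [folklore] -/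
theorem fderiv_zero_eq_of_sq_bound {T : 𝒴' →L[ℂ] 𝒳} {C r : ℝ} (hr : 0 < r)
    (h : ∀ B ∈ ball (0 : 𝒴') r, ‖Qt B - T B‖ ≤ C * ‖B‖ ^ 2) : fderiv ℂ Qt 0 = T :=
  (hasFDerivAt_zero_of_sq_bound hr h).fderiv

/-- … hence, inside the ball, `landauCf Qt R Z = Qt Z − T Z` IS the printed remainder «C_k(U₀, ·)». [folklore] -/
theorem landauCf_eq_sub_of_sq_bound {T : 𝒴' →L[ℂ] 𝒳} {C r : ℝ} (hr : 0 < r)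
    (h : ∀ B ∈ ball (0 : 𝒴') r, ‖Qt B - T B‖ ≤ C * ‖B‖ ^ 2) {Z : 𝒴'} (hZ : ‖Z‖ < R) :
    landauCf Qt R Z = Qt Z - T Z := by
  rw [landauCf_eq_sub hZ, fderiv_zero_eq_of_sq_bound hr h]

/-- **END-II's `hCq` WITH THE DISPLAYED CONSTANT**: from «`‖Q(B) − TB‖ ≤ C₂‖B‖²` on `ball 0 r`» ((135)'s SHAPE) and
`R ≤ r`: `‖landauCf Qt R Z‖ ≤ C₂‖Z‖²` for `‖Z‖ < R` — no `M_Q∕R²` loss; this is the socket for the `k`-UNIFORM constant of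
rows S55∕S56 once `prop4_general` lands. [folklore] -/
theorem norm_landauCf_le_of_sq_bound {T : 𝒴' →L[ℂ] 𝒳} {C r : ℝ} (hr : 0 < r)
    (h : ∀ B ∈ ball (0 : 𝒴') r, ‖Qt B - T B‖ ≤ C * ‖B‖ ^ 2) (hRr : R ≤ r) :
    ∀ Z : 𝒴', ‖Z‖ < R → ‖landauCf Qt R Z‖ ≤ C * ‖Z‖ ^ 2 := fun Z hZ => by
  rw [landauCf_eq_sub_of_sq_bound hr h hZ]
  exact h Z (mem_ball_zero_iff.2 (hZ.trans_le hRr))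

/-! ## §2 The plug into B11 Sect. C: the Landau correction EXISTS along every holomorphic curve -/

/-- **B11 (50)–(55) FOR A `Cf` READ OFF A CHART MAP** — `ShellMeasureLandauFixedPoint.landauCorrection_along` with its
hypothesis pair ((44) + [4] Prop. 7 in Fréchet form: `hCq`, `hCd`) DISCHARGED by §1 from (Q1)–(Q3): given the scaling
`ι` (`‖ι Y‖ ≤ ‖Y‖`), an operator `H` with (46)-TYPE bound `B₀`, the (54)-TYPE smallness `9·C₂·B₀·ε < 1` at
`C₂ = 2M_Q∕R²` and `3ε ≤ R`, along any holomorphic curve `σ ↦ Y_σ`, `‖Y_σ‖ < ε` on a disc: a holomorphic `σ ↦ D_σ` in the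
closed ball `4C₂ε²` solving (50) `Cf(ι Y_σ − ι H D_σ) = D_σ`, unique there, with (55) `‖D_σ‖ ≤ 4C₂‖ι Y_σ‖²`. [folklore] -/
theorem landauCorrection_along_of_Q [CompleteSpace 𝒳] {𝒴 : Type*} [NormedAddCommGroup 𝒴] [NormedSpace ℂ 𝒴]
    (hR : 0 < R) (hQa : AnalyticOnNhd ℂ Qt (ball 0 R)) (hQM : ∀ B ∈ ball (0 : 𝒴') R, ‖Qt B‖ ≤ MQ) (hQ0 : Qt 0 = 0)
    (ι : 𝒴 →L[ℂ] 𝒴') (hι : ∀ Y, ‖ι Y‖ ≤ ‖Y‖) (H : 𝒳 →L[ℂ] 𝒴) {B₀ : ℝ} (hB₀ : 0 ≤ B₀)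
    (hH : ∀ X, ‖H X‖ ≤ B₀ * ‖X‖) {ε Rad : ℝ} (hq : 9 * Mq R MQ * B₀ * ε < 1) (hRC : 3 * ε ≤ R)
    {Y : ℂ → 𝒴} (hYd : DifferentiableOn ℂ Y (ball 0 Rad)) (hY : ∀ σ ∈ ball (0 : ℂ) Rad, ‖Y σ‖ < ε) :
    ∃ Dc : ℂ → 𝒳, DifferentiableOn ℂ Dc (ball 0 Rad) ∧ ∀ σ ∈ ball (0 : ℂ) Rad,
      Dc σ ∈ closedBall (0 : 𝒳) (4 * Mq R MQ * ε ^ 2) ∧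
      landauCf Qt R (ι (Y σ) - ι (H (Dc σ))) = Dc σ ∧
      (∀ X' ∈ closedBall (0 : 𝒳) (4 * Mq R MQ * ε ^ 2), landauCf Qt R (ι (Y σ) - ι (H X')) = X' → X' = Dc σ) ∧
      ‖Dc σ‖ ≤ 4 * Mq R MQ * ‖ι (Y σ)‖ ^ 2 :=
  landauCorrection_along (C₂_nonneg hR hQM) (norm_landauCf_le_sq hR hQa hQM hQ0) (differentiableOn_landauCf hQa)
    ι hι H hB₀ hH hq hRC hYd hY

end Summit.QuantumFields.BalabanUV.T4Continuum.ShellMeasureLandauCorrectionFromQ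

end
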